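import Literature.NumberTheory.EllipticCurves.PNewBranchGaloisLattice
import HarnessLib

/-!
# Telescope line, crux 4 `BSDpOnCellC` — API of the Galois-lattice fact T-An-2ᵍ (`PNewBranchGaloisLattice`)

Helper (closes NO registered stub; `--supports stmt-BirchSwinnertonDyer-19034 --as helper`), seat `bsd-idea-12` g42.
One-line consequences of the Literature named fact `hida1986_castella2020_exists_galoisLattice_on_pNewBranchChart`
(T-An-2ᵍ) and of its predicate `IsBranchGaloisLattice`, in the shapes the two parked cite-slots of the skeleton consume:
* `twoVariableBDP_of_galoisLattice : T-An-2ᵍ → T-An-2` (so the LANDED analytic bridge for T-An-2 is reused verbatim by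
  `stub_analyticBridgeRational`, and (rat) is read off the SAME witnesses by `surjective_algebraMap`);
* the clause projections `isUnramifiedAt` (G-unr), `exists_fibre_zero` (G-fib₀), `exists_fibre_member` (G-fib_t),
  `surjective_algebraMap` (G-rat);
* `Matrix.map_eq_of_weierstrassRemainder` / `exists_fibre_member_map` — the Weierstrass-remainder clause READ THROUGH ANY
  `ℤ_p`-point `φ : ℤ_p⟦X⟧ →+* ℤ_p` with `φ ∘ C = id`, `φ X = x_t` (e.g. the tree's `evalHom (x t) _`): `(ρ σ).map φ = M σ`,
  the currency of N1♭'s member clause `∃ φ, (∀ r, φ (C r) = r) ∧ φ X = x k ∧ …`.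
No new mathematics; BSD is proved for no curve by this file; no summit statement / crux / registered stub is proved.
-/

set_option linter.dupNamespace false

noncomputable section

open scoped MatrixGroups Topology PowerSeries.WithPiTopology

open NumberField IsDedekindDomain Field
  Literature.NumberTheory.GaloisRepresentations
  Literature.NumberTheory.EllipticCurves
  Literature.NumberTheory.EllipticCurves.ModularForms
  Literature.NumberTheory.EllipticCurves.GreenbergSelmer

namespace Summit.BirchSwinnertonDyer.BirchSwinnertonDyer.Theorems.TelescopeBranchGaloisLatticeAPI

/-! ### T-An-2ᵍ ⇒ T-An-2 (forget the lattice) -/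

/-- Forgetting the lattice: the packaged fact implies T-An-2 `castella2020_exists_twoVariableBDP_on_pNewBranchChart`
verbatim, so every landed consumer of T-An-2 consumes T-An-2ᵍ. -/
theorem twoVariableBDP_of_galoisLattice
    (h : hida1986_castella2020_exists_galoisLattice_on_pNewBranchChart) :
    castella2020_exists_twoVariableBDP_on_pNewBranchChart := by
  intro p _ ι W _ _ K _ _ 𝔭 κ γ _ N _ f hf hN hp hmult hK hodd hdisc hH hsplit h𝔭 hι hanti j hj
  obtain ⟨A, x, D, hchart, hpkg, -⟩ :=
    h ι W K 𝔭 κ γ hf hN hp hmult hK hodd hdisc hH hsplit h𝔭 hι hanti j hj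
  exact ⟨A, x, D, hchart, hpkg⟩

/-! ### Reading a Weierstrass remainder through a `ℤ_p`-point of `ℤ_p⟦X⟧` -/

/-- If `A = C(M) + (X − C c)·U` entrywise and `φ : ℤ_p⟦X⟧ →+* ℤ_p` fixes constants and sends `X ↦ c`, then `A.map φ = M`. -/
theorem Matrix.map_eq_of_weierstrassRemainder {m : Type*} {p : ℕ} [Fact p.Prime] {c : ℤ_[p]}
    (φ : PowerSeries ℤ_[p] →+* ℤ_[p]) (hC : ∀ r : ℤ_[p], φ (PowerSeries.C r) = r)
    (hX : φ PowerSeries.X = c) {A U : Matrix m m (PowerSeries ℤ_[p])} {M : Matrix m m ℤ_[p]}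
    (h : A = M.map (PowerSeries.C (R := ℤ_[p])) + (PowerSeries.X - PowerSeries.C c) • U) :
    A.map φ = M := by
  ext i j
  rw [h]
  simp [Matrix.map_apply, Matrix.add_apply, Matrix.smul_apply, map_add, map_mul, map_sub, hC, hX]

/-! ### The four clauses of `IsBranchGaloisLattice` by name (plain application `exists_fibre_zero h`, not dot notation) -/

variable {W : WeierstrassCurve ℚ} [W.IsElliptic] [W.IsGloballyMinimal] {p : ℕ} [Fact p.Prime]
  {x : ℕ → ℤ_[p]} {D : ℕ → Skinner2016.HidaCongruentForm W p 1} {ρ : FramedGaloisRep ℚ (PowerSeries ℤ_[p]) 2}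

/-- (G-unr): `ρ` is unramified at every finite place `v ∤ N`. -/
theorem isUnramifiedAt (h : IsBranchGaloisLattice W p x D ρ) {v : HeightOneSpectrum (𝓞 ℚ)}
    (hv : ¬ ((Rat.HeightOneSpectrum.primesEquiv v : Nat.Primes) : ℕ) ∣ W.conductorNorm ℤ) :
    ρ.IsUnramifiedAt v :=
  h.1 v hv

/-- (G-fib₀): the `X = 0` fibre is conjugate over `ℚ_p` to the Tate-module representation. -/
theorem exists_fibre_zero (h : IsBranchGaloisLattice W p x D ρ) :
    ∃ (b : Module.Basis (Fin 2) ℤ_[p] (W.tateModule p)) (P : GL (Fin 2) ℚ_[p]),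
      ∀ σ : absoluteGaloisGroup ℚ,
        (((ρ σ : GL (Fin 2) (PowerSeries ℤ_[p])) : Matrix (Fin 2) (Fin 2) (PowerSeries ℤ_[p])).map
            (fun F : PowerSeries ℤ_[p] => ((PowerSeries.constantCoeff F : ℤ_[p]) : ℚ_[p]))) =
          ((P : GL (Fin 2) ℚ_[p]) : Matrix (Fin 2) (Fin 2) ℚ_[p]) *
            (LinearMap.toMatrix b b (W.galoisRepTate p σ)).map (fun z : ℤ_[p] => (z : ℚ_[p])) *
            ((P⁻¹ : GL (Fin 2) ℚ_[p]) : Matrix (Fin 2) (Fin 2) ℚ_[p]) :=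
  h.2.1

/-- (G-fib_t): the fibre at the member point `x_t`, as a Weierstrass remainder, conjugate over `K_t` to the member's
self-dual datum. -/
theorem exists_fibre_member (h : IsBranchGaloisLattice W p x D ρ) (t : ℕ) :
    ∃ (M : absoluteGaloisGroup ℚ → Matrix (Fin 2) (Fin 2) ℤ_[p])
      (U : absoluteGaloisGroup ℚ → Matrix (Fin 2) (Fin 2) (PowerSeries ℤ_[p]))
      (P : GL (Fin 2) (padicCoeffField (D t).ι)),
    ∀ σ : absoluteGaloisGroup ℚ,
      (((ρ σ : GL (Fin 2) (PowerSeries ℤ_[p])) : Matrix (Fin 2) (Fin 2) (PowerSeries ℤ_[p])) =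
        (M σ).map (PowerSeries.C (R := ℤ_[p])) + (PowerSeries.X - PowerSeries.C (x t)) • U σ) ∧
      (M σ).map (fun z : ℤ_[p] => algebraMap ℚ_[p] (padicCoeffField (D t).ι) (z : ℚ_[p])) =
        ((P : GL (Fin 2) (padicCoeffField (D t).ι)) : Matrix (Fin 2) (Fin 2) (padicCoeffField (D t).ι)) *
          ((((D t).Δ.selfDualRep σ : GL (Fin 2) (padicCoeffIntegers (D t).ι)) :
              Matrix (Fin 2) (Fin 2) (padicCoeffIntegers (D t).ι)).map
            (fun z : padicCoeffIntegers (D t).ι => (z : padicCoeffField (D t).ι))) *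
          ((P⁻¹ : GL (Fin 2) (padicCoeffField (D t).ι)) : Matrix (Fin 2) (Fin 2) (padicCoeffField (D t).ι)) :=
  h.2.2.1 t

/-- (G-rat): the members are `ℚ_p`-rational — `ℤ_p → 𝒪_t` is onto. -/
theorem surjective_algebraMap (h : IsBranchGaloisLattice W p x D ρ) (t : ℕ) :
    Function.Surjective (algebraMap ℤ_[p] (padicCoeffIntegers (D t).ι)) :=
  h.2.2.2 t

/-- (G-fib_t) read through ANY `ℤ_p`-point `φ` of `ℤ_p⟦X⟧` at `x_t` (`φ ∘ C = id`, `φ X = x_t`; e.g. `evalHom (x t) _`):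
the evaluated matrices `(ρ σ).map φ` ARE the fibre `M σ`, conjugate over `K_t` to the member's self-dual datum — the
currency of N1♭'s member clause. -/
theorem exists_fibre_member_map (h : IsBranchGaloisLattice W p x D ρ) (t : ℕ)
    (φ : PowerSeries ℤ_[p] →+* ℤ_[p]) (hC : ∀ r : ℤ_[p], φ (PowerSeries.C r) = r) (hX : φ PowerSeries.X = x t) :
    ∃ (P : GL (Fin 2) (padicCoeffField (D t).ι)),
    ∀ σ : absoluteGaloisGroup ℚ,
      (((ρ σ : GL (Fin 2) (PowerSeries ℤ_[p])) : Matrix (Fin 2) (Fin 2) (PowerSeries ℤ_[p])).map φ).map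
          (fun z : ℤ_[p] => algebraMap ℚ_[p] (padicCoeffField (D t).ι) (z : ℚ_[p])) =
        ((P : GL (Fin 2) (padicCoeffField (D t).ι)) : Matrix (Fin 2) (Fin 2) (padicCoeffField (D t).ι)) *
          ((((D t).Δ.selfDualRep σ : GL (Fin 2) (padicCoeffIntegers (D t).ι)) :
              Matrix (Fin 2) (Fin 2) (padicCoeffIntegers (D t).ι)).map
            (fun z : padicCoeffIntegers (D t).ι => (z : padicCoeffField (D t).ι))) *
          ((P⁻¹ : GL (Fin 2) (padicCoeffField (D t).ι)) : Matrix (Fin 2) (Fin 2) (padicCoeffField (D t).ι)) := by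
  obtain ⟨M, U, P, hMUP⟩ := exists_fibre_member h t
  refine ⟨P, fun σ => ?_⟩
  rw [Matrix.map_eq_of_weierstrassRemainder φ hC hX (hMUP σ).1]
  exact (hMUP σ).2


end Summit.BirchSwinnertonDyer.BirchSwinnertonDyer.Theorems.TelescopeBranchGaloisLatticeAPI

end
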